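import Mathlib.Analysis.Normed.Operator.Banach
import Mathlib.Topology.ContinuousMap.Bounded.Normed
import Literature.Analysis.UnboundedOperators.LinearizedBoltzmannBoundedImage
import Literature.Analysis.UnboundedOperators.LinearizedBoltzmannKernelActionContinuity
import Summits.AtomisticToContinuum.HydrodynamicLimit.Theorems.AntiMazurCoboundariesCellForecastPressureDecayEnskogObjects
import HarnessLib

/-!
# Stub S1 `stub_poissonCorrector` of the line `enskog-compensator-martingale` — the reduction
# (crux `CellForecastPressureDecay`, stmt-AtomisticToContinuum-13915)

S1 asks for Grad's **sup-norm** inverse of the in-tree linearised hard-sphere operator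
`L = hardSphereLinearizedOp` of `ℝ³`: every bounded continuous `g ⊥ span{1, v, |v|²}` (the crux's
clause `Orthogonal g`) has SOME bounded continuous pre-image `w`, `L w = g`, with `‖w‖_∞ ≤ C₀ ‖g‖_∞`
for an absolute `C₀`. The tree (crux stmt-AtomisticToContinuum-10967's seat, 2026-08-16) has the
continuous `M`-orthogonal inverse with Gaussian / sub-Gaussian / quartic growth
(`exists_continuous_inverse_hardSphereLinearizedOp[_subGaussian|_quartic]`) and the NEGATIVE fact that
the `M`-orthogonal inverse is in general unbounded (`LinearizedBoltzmannOrthogonalInverseUnbounded`: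
it carries a non-trivial element of `span{v, |v|²}`); the borderline sup-norm step — SOME bounded
pre-image — is not landed. This file proves everything of S1 that is NOT that step:

* § 1 the bridge between the crux's orthogonality clause and the Literature vocabulary:
  `Orthogonal g ↔ ∀ φ ∈ collisionInvariants V3, maxwellianInner g φ = 0` (`orthogonal_iff`);
* § 2 `L` on bounded functions: the sup bound `|L ψ (v)| ≤ 4 ‖ψ‖_∞ ν(v)`, additivity
  (`abs_hardSphereLinearizedOp_le_of_bounded`, `hardSphereLinearizedOp_sub_of_bounded`,
  `hardSphereLinearizedOp_add_of_bounded`), whence `L` at a fixed velocity is a continuous linear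
  functional on `C_b(ℝ³)` (`exists_opCLM`), and automatic continuity of bounded measurable solutions of
  `L ψ = g`, `g` continuous (`continuous_of_bounded_of_eq`);
* § 3 the functional-analytic frame: the closed subspace `X ⊆ C_b(ℝ³)` of functions orthogonal to the
  invariants (`exists_orthSubspace`), the closed graph `G ⊆ C_b × X` of `L` (`exists_graphSubspace`), both
  Banach (existence forms: the file introduces no definitions);
* § 4 **the open-mapping upgrade** (`stub_poissonCorrector_of_exists`, registered sub-goal): the purely
  QUALITATIVE solvability "every bounded continuous `g ⊥` invariants has some bounded measurable
  pre-image" already implies S1 with a UNIFORM constant `C₀` (automatic continuity of bounded solutions,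
  `continuous_of_bounded_of_eq`, then Banach's open mapping theorem for the
  surjection `G → X`, `(ψ, g) ↦ g`) — the route flagged by the refuters of 10967's twin stub
  (`Cruxes/KineticFluxLdDecay/NegativeNotes-g2-stub_chapmanEnskogInverse.md`, (iii)): the asymptotic
  analysis need not track constants;
* § 5 the mechanical corollary `stub_poissonCorrector_of_bounded`: S1 from the sup-norm statement in the
  Literature vocabulary (the form crux 10967's seat will land), so that S1 closes by one `exact` then.

No new obligations; the registered stub `stub_poissonCorrector` itself stays open here (it is
byte-identical to `stub_chapmanEnskogInverse` of crux stmt-AtomisticToContinuum-10967, in flight there).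
-/

noncomputable section

-- Mathlib's own setting; needed to synthesise the normed-space structure of continuous linear maps out of
-- subtypes `↥X`, `↥G` of submodules of `C_b(ℝ³)` and `C_b(ℝ³) × ↥X` (nested instance problems of depth 2).
set_option maxSynthPendingDepth 3

open MeasureTheory ProbabilityTheory Set Filter
open scoped ENNReal BigOperators InnerProductSpace BoundedContinuousFunction
open Literature.Analysis.FluidPDE Literature.MathematicalPhysics.KineticTheory
open Literature.Analysis.UnboundedOperators (hardSphereLinearizedOp collisionInvariants maxwellianInner
  mem_collisionInvariants_iff collisionFrequency integrable_sphereIntegral_hardSphereKernel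
  hardSphereLinearizedOp_eq_kernel_sub_of_gaussGrowth kernelAction_sub_of_gaussGrowth
  hardSphereLinearizedOp_const_mul integrable_stdGaussian_of_hasTemperateGrowth
  continuous_of_gaussGrowth_of_fixedPoint)
open Summit.AtomisticToContinuum.HydrodynamicLimit.Theorems.CellForecastPressureDecay
  (cellRef vel_localClusterState_of_card_le_one)

namespace Summit.AtomisticToContinuum.HydrodynamicLimit.Theorems.EnskogCompensator

/-! ## § 1 The orthogonality clause in the Literature vocabulary -/

/-- **Bridge.** The crux's clause `Orthogonal g` (`∫ g · (c₀ + ⟪b, v⟫ + c₂ |v|²) dM = 0` for all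
`c₀, c₂, b`) is literally `M`-orthogonality of `g` to the collision invariants `span{1, v, |v|²}` in the
vocabulary of `Literature.Analysis.UnboundedOperators` (`maxwellianInner`, `collisionInvariants`), by the
normal form `mem_collisionInvariants_iff`. No integrability is needed. [folklore] -/
theorem orthogonal_iff {g : V3 → ℝ} :
    Orthogonal g ↔ ∀ φ ∈ collisionInvariants V3, maxwellianInner g φ = 0 := by
  constructor
  · intro h φ hφ
    obtain ⟨a, c, b, rfl⟩ := mem_collisionInvariants_iff.1 hφ
    exact h a c b
  · intro h c₀ c₂ b
    exact h _ (mem_collisionInvariants_iff.2 ⟨c₀, c₂, b, rfl⟩)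

/-- The three moment identities packed in `Orthogonal g`: zero Maxwellian mean, zero momentum overlap,
zero energy overlap. [folklore] -/
theorem Orthogonal.moments {g : V3 → ℝ} (h : Orthogonal g) :
    ∫ v, g v ∂stdGaussian V3 = 0 ∧ (∀ b : V3, ∫ v, g v * ⟪b, v⟫_ℝ ∂stdGaussian V3 = 0) ∧
      ∫ v, g v * ‖v‖ ^ 2 ∂stdGaussian V3 = 0 := by
  refine ⟨?_, fun b => ?_, ?_⟩
  · simpa using h 1 0 0
  · simpa using h 0 0 b
  · simpa using h 0 1 0

/-! ## § 2 The linearised operator on bounded functions -/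

/-- **Sup bound.** For a bounded measurable `ψ`, `|L ψ (v)| ≤ 4 ‖ψ‖_∞ ν(v)` at every velocity
(`ν = collisionFrequency`): the integrand of `L ψ (v)` is `((v - v_*)·ω)₊ (ψ' + ψ_*' - ψ - ψ_*)`.
[folklore] -/
theorem abs_hardSphereLinearizedOp_le_of_bounded {ψ : V3 → ℝ} {A : ℝ} (hA : ∀ x, |ψ x| ≤ A) (v : V3) :
    |hardSphereLinearizedOp ψ v| ≤ 4 * A * collisionFrequency v := by
  haveI := isFiniteMeasure_sphereMeasure (E := V3)
  have hinner : ∀ w, ‖∫ ω, hardSphereKernel (v, w) ω *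
      (ψ (collide ω (v, w)).1 + ψ (collide ω (v, w)).2 - ψ v - ψ w) ∂sphereMeasure‖ ≤
      4 * A * ∫ ω, hardSphereKernel (v, w) ω ∂sphereMeasure := by
    intro w
    have hc : Continuous fun ω : Metric.sphere (0 : V3) 1 => hardSphereKernel (v, w) ω := by
      unfold hardSphereKernel; fun_prop
    have hi : Integrable (fun ω => hardSphereKernel (v, w) ω) sphereMeasure :=
      hc.integrable_of_hasCompactSupport (HasCompactSupport.of_compactSpace _)
    rw [← integral_const_mul]
    refine norm_integral_le_of_norm_le (hi.const_mul _) (Eventually.of_forall fun ω => ?_)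
    have hB0 : 0 ≤ hardSphereKernel (v, w) ω := le_max_right _ _
    rw [Real.norm_eq_abs, abs_mul, abs_of_nonneg hB0]
    have h1 := hA (collide ω (v, w)).1
    have h2 := hA (collide ω (v, w)).2
    have h3 := hA v
    have h4 := hA w
    have hs : |ψ (collide ω (v, w)).1 + ψ (collide ω (v, w)).2 - ψ v - ψ w| ≤ 4 * A := by
      rw [abs_le]
      rw [abs_le] at h1 h2 h3 h4
      constructor <;> linarith
    calc hardSphereKernel (v, w) ω * |ψ (collide ω (v, w)).1 + ψ (collide ω (v, w)).2 - ψ v - ψ w|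
        ≤ hardSphereKernel (v, w) ω * (4 * A) := mul_le_mul_of_nonneg_left hs hB0
      _ = 4 * A * hardSphereKernel (v, w) ω := by ring
  unfold hardSphereLinearizedOp Literature.Analysis.UnboundedOperators.linearizedCollisionOp
  rw [← Real.norm_eq_abs]
  calc ‖∫ w, ∫ ω, hardSphereKernel (v, w) ω *
          (ψ (collide ω (v, w)).1 + ψ (collide ω (v, w)).2 - ψ v - ψ w) ∂sphereMeasure ∂stdGaussian V3‖
      ≤ ∫ w, 4 * A * ∫ ω, hardSphereKernel (v, w) ω ∂sphereMeasure ∂stdGaussian V3 :=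
        norm_integral_le_of_norm_le ((integrable_sphereIntegral_hardSphereKernel v).const_mul _)
          (Eventually.of_forall hinner)
    _ = 4 * A * collisionFrequency v := by rw [integral_const_mul]; rfl

/-- A bounded function has Gaussian growth `|ψ| ≤ ‖ψ‖_∞ e^{|·|²/4}` (the tree's hypothesis for Grad's
absolutely convergent splitting `L = K - ν`). [folklore] -/
theorem gaussGrowth_of_bounded {ψ : V3 → ℝ} {A : ℝ} (hA : ∀ x, |ψ x| ≤ A) (x : V3) :
    |ψ x| ≤ A * Real.exp (‖x‖ ^ 2 / 4) :=
  (hA x).trans (le_mul_of_one_le_right ((abs_nonneg _).trans (hA x)) (Real.one_le_exp (by positivity)))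

/-- **Additivity of `L` on bounded measurable functions** (subtraction form): Grad's splitting
`L = K - ν` converges absolutely for bounded functions, and `K` is additive there
(`kernelAction_sub_of_gaussGrowth`). [folklore] -/
theorem hardSphereLinearizedOp_sub_of_bounded {ψ₁ ψ₂ : V3 → ℝ} (h₁ : Measurable ψ₁) (h₂ : Measurable ψ₂)
    {A₁ A₂ : ℝ} (hA₁ : ∀ x, |ψ₁ x| ≤ A₁) (hA₂ : ∀ x, |ψ₂ x| ≤ A₂) (v : V3) :
    hardSphereLinearizedOp (ψ₁ - ψ₂) v = hardSphereLinearizedOp ψ₁ v - hardSphereLinearizedOp ψ₂ v := by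
  have hC₁ := gaussGrowth_of_bounded hA₁
  have hC₂ := gaussGrowth_of_bounded hA₂
  have hC₁₂ : ∀ x, |(ψ₁ - ψ₂) x| ≤ (A₁ + A₂) * Real.exp (‖x‖ ^ 2 / 4) := fun x => by
    rw [Pi.sub_apply, add_mul]
    exact (abs_sub _ _).trans (add_le_add (hC₁ x) (hC₂ x))
  rw [hardSphereLinearizedOp_eq_kernel_sub_of_gaussGrowth (h₁.sub h₂) hC₁₂ v,
    kernelAction_sub_of_gaussGrowth h₁ h₂ hC₁ hC₂ v,
    hardSphereLinearizedOp_eq_kernel_sub_of_gaussGrowth h₁ hC₁ v,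
    hardSphereLinearizedOp_eq_kernel_sub_of_gaussGrowth h₂ hC₂ v, Pi.sub_apply]
  ring

/-- **Additivity of `L` on bounded measurable functions.** [folklore] -/
theorem hardSphereLinearizedOp_add_of_bounded {ψ₁ ψ₂ : V3 → ℝ} (h₁ : Measurable ψ₁) (h₂ : Measurable ψ₂)
    {A₁ A₂ : ℝ} (hA₁ : ∀ x, |ψ₁ x| ≤ A₁) (hA₂ : ∀ x, |ψ₂ x| ≤ A₂) (v : V3) :
    hardSphereLinearizedOp (ψ₁ + ψ₂) v = hardSphereLinearizedOp ψ₁ v + hardSphereLinearizedOp ψ₂ v := by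
  have hA₁₂ : ∀ x, |(ψ₁ + ψ₂) x| ≤ A₁ + A₂ := fun x =>
    (abs_add_le _ _).trans (add_le_add (hA₁ x) (hA₂ x))
  have key := hardSphereLinearizedOp_sub_of_bounded (h₁.add h₂) h₂ hA₁₂ hA₂ v
  rw [add_sub_cancel_right] at key
  linarith

/-- **Automatic continuity.** A bounded measurable solution `ψ` of `L ψ = g` (pointwise) with continuous
`g` is continuous: by Grad's splitting it solves `ν ψ = K ψ - g` with `K ψ` and `ν > 0` continuous
(`continuous_of_gaussGrowth_of_fixedPoint`). So pre-images may be sought among bounded MEASURABLE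
functions. [folklore] -/
theorem continuous_of_bounded_of_eq {ψ g : V3 → ℝ} (hψ : Measurable ψ) {B : ℝ} (hB : ∀ v, |ψ v| ≤ B)
    (hg : Continuous g) (hL : ∀ v, hardSphereLinearizedOp ψ v = g v) : Continuous ψ := by
  have hC := gaussGrowth_of_bounded hB
  refine continuous_of_gaussGrowth_of_fixedPoint hψ hC hg fun v => ?_
  have h := hardSphereLinearizedOp_eq_kernel_sub_of_gaussGrowth hψ hC v
  rw [hL v] at h
  linarith

/-- A bounded continuous function is bounded by its sup norm, in absolute value. [folklore] -/
theorem abs_apply_le_norm (ψ : V3 →ᵇ ℝ) (x : V3) : |ψ x| ≤ ‖ψ‖ := by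
  rw [← Real.norm_eq_abs]; exact ψ.norm_coe_le_norm x

/-- A continuous function with a two-sided bound `b` is (the coercion of) a bounded continuous function of
sup norm `≤ b`. [folklore] -/
theorem exists_bcf_of_bounded {g : V3 → ℝ} (hg : Continuous g) {b : ℝ} (hb : ∀ v, |g v| ≤ b) :
    ∃ gb : V3 →ᵇ ℝ, ⇑gb = g ∧ ‖gb‖ ≤ b :=
  ⟨BoundedContinuousFunction.ofNormedAddCommGroup g hg b fun v => by rw [Real.norm_eq_abs]; exact hb v,
    rfl, BoundedContinuousFunction.norm_ofNormedAddCommGroup_le hg ((abs_nonneg _).trans (hb 0)) _⟩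

/-- **`L` at a fixed velocity is a continuous linear functional on `C_b(ℝ³)`** (of norm `≤ 4 ν(v)`;
existence form, so that this file introduces no definitions). [folklore] -/
theorem exists_opCLM (v : V3) :
    ∃ T : (V3 →ᵇ ℝ) →L[ℝ] ℝ, ∀ ψ : V3 →ᵇ ℝ, T ψ = hardSphereLinearizedOp ⇑ψ v := by
  refine ⟨LinearMap.mkContinuous
    { toFun := fun ψ => hardSphereLinearizedOp ⇑ψ v
      map_add' := fun ψ₁ ψ₂ => ?_
      map_smul' := fun c ψ => ?_ } (4 * collisionFrequency v) fun ψ => ?_, fun ψ => rfl⟩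
  · rw [BoundedContinuousFunction.coe_add]
    exact hardSphereLinearizedOp_add_of_bounded ψ₁.continuous.measurable ψ₂.continuous.measurable
      (abs_apply_le_norm ψ₁) (abs_apply_le_norm ψ₂) v
  · change hardSphereLinearizedOp (fun x => c * ψ x) v = c * hardSphereLinearizedOp ⇑ψ v
    rw [hardSphereLinearizedOp_const_mul]
  · change ‖hardSphereLinearizedOp ⇑ψ v‖ ≤ 4 * collisionFrequency v * ‖ψ‖
    rw [Real.norm_eq_abs]
    calc |hardSphereLinearizedOp ⇑ψ v| ≤ 4 * ‖ψ‖ * collisionFrequency v :=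
          abs_hardSphereLinearizedOp_le_of_bounded (abs_apply_le_norm ψ) v
      _ = 4 * collisionFrequency v * ‖ψ‖ := by ring

/-! ## § 3 The functional-analytic frame: `X = C_b ∩ (invariants)^⊥` and the graph of `L` over `X` -/

/-- The quadratic collision invariant `v ↦ c₀ + ⟪b, v⟫ + c₂ |v|²` is `M`-integrable. [folklore] -/
theorem integrable_invariant (c₀ c₂ : ℝ) (b : V3) :
    Integrable (fun v : V3 => c₀ + ⟪b, v⟫_ℝ + c₂ * ‖v‖ ^ 2) (stdGaussian V3) :=
  integrable_stdGaussian_of_hasTemperateGrowth (by fun_prop)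

/-- A bounded continuous function times a quadratic collision invariant is `M`-integrable. [folklore] -/
theorem integrable_mul_invariant (g : V3 →ᵇ ℝ) (c₀ c₂ : ℝ) (b : V3) :
    Integrable (fun v : V3 => g v * (c₀ + ⟪b, v⟫_ℝ + c₂ * ‖v‖ ^ 2)) (stdGaussian V3) :=
  (integrable_invariant c₀ c₂ b).bdd_mul g.continuous.aestronglyMeasurable
    (Eventually.of_forall fun v => g.norm_coe_le_norm v)

/-- **The pairing with a quadratic collision invariant** `g ↦ ∫ g · (c₀ + ⟪b, ·⟫ + c₂ |·|²) dM` is a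
continuous linear functional on `C_b(ℝ³)` (bound `∫ |c₀ + ⟪b, v⟫ + c₂ |v|²| dM(v)`; existence form).
[folklore] -/
theorem exists_pairingCLM (c₀ c₂ : ℝ) (b : V3) :
    ∃ T : (V3 →ᵇ ℝ) →L[ℝ] ℝ, ∀ g : V3 →ᵇ ℝ, T g = ∫ v, g v * (c₀ + ⟪b, v⟫_ℝ + c₂ * ‖v‖ ^ 2) ∂stdGaussian V3 := by
  refine ⟨LinearMap.mkContinuous
    { toFun := fun g => ∫ v, g v * (c₀ + ⟪b, v⟫_ℝ + c₂ * ‖v‖ ^ 2) ∂stdGaussian V3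
      map_add' := fun g₁ g₂ => ?_
      map_smul' := fun c g => ?_ } (∫ v, ‖c₀ + ⟪b, v⟫_ℝ + c₂ * ‖v‖ ^ 2‖ ∂stdGaussian V3) fun g => ?_,
    fun g => rfl⟩
  · simp only [BoundedContinuousFunction.coe_add, Pi.add_apply, add_mul]
    exact integral_add (integrable_mul_invariant g₁ c₀ c₂ b) (integrable_mul_invariant g₂ c₀ c₂ b)
  · simp only [BoundedContinuousFunction.coe_smul, smul_eq_mul, RingHom.id_apply, mul_assoc]
    exact integral_const_mul _ _
  · change ‖∫ v, g v * (c₀ + ⟪b, v⟫_ℝ + c₂ * ‖v‖ ^ 2) ∂stdGaussian V3‖ ≤ _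
    rw [mul_comm, ← integral_const_mul]
    refine norm_integral_le_of_norm_le (((integrable_invariant c₀ c₂ b).norm).const_mul _)
      (Eventually.of_forall fun v => ?_)
    rw [norm_mul]
    exact mul_le_mul_of_nonneg_right (g.norm_coe_le_norm v) (norm_nonneg _)

/-- **The space `X`**: the bounded continuous functions `M`-orthogonal to the collision invariants form a
CLOSED subspace of the Banach space `C_b(ℝ³)` (the intersection of the kernels of the pairings), whose
membership is the crux's orthogonality clause. [folklore] -/
theorem exists_orthSubspace :
    ∃ X : Submodule ℝ (V3 →ᵇ ℝ), IsClosed (X : Set (V3 →ᵇ ℝ)) ∧ ∀ g : V3 →ᵇ ℝ, g ∈ X ↔ Orthogonal ⇑g := by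
  choose T hT using exists_pairingCLM
  refine ⟨⨅ c₀ : ℝ, ⨅ c₂ : ℝ, ⨅ b : V3, (T c₀ c₂ b).ker, ?_, fun g => ?_⟩
  · simp only [Submodule.coe_iInf]
    exact isClosed_iInter fun c₀ => isClosed_iInter fun c₂ => isClosed_iInter fun b =>
      ContinuousLinearMap.isClosed_ker _
  · simp only [Submodule.mem_iInf, LinearMap.mem_ker, ContinuousLinearMap.coe_coe, hT]
    rfl

/-- **The graph `G` of `L` over a subspace `X ⊆ C_b(ℝ³)`**: the pairs `(ψ, g) ∈ C_b × X` with `L ψ = g`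
pointwise form a CLOSED subspace of `C_b × X` (each condition `L ψ (v) = g(v)` is the equaliser of two
continuous functionals, by the sup bound `|L ψ (v)| ≤ 4 ν(v) ‖ψ‖_∞`). [folklore] -/
theorem exists_graphSubspace (X : Submodule ℝ (V3 →ᵇ ℝ)) :
    ∃ G : Submodule ℝ ((V3 →ᵇ ℝ) × X), IsClosed (G : Set ((V3 →ᵇ ℝ) × X)) ∧
      ∀ q : (V3 →ᵇ ℝ) × X, q ∈ G ↔ ∀ v, hardSphereLinearizedOp ⇑q.1 v = (q.2 : V3 →ᵇ ℝ) v := by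
  choose T hT using exists_opCLM
  refine ⟨⨅ v : V3, ((T v).comp (ContinuousLinearMap.fst ℝ (V3 →ᵇ ℝ) X)).eqLocus
      ((BoundedContinuousFunction.evalCLM ℝ v).comp (X.subtypeL.comp (ContinuousLinearMap.snd ℝ (V3 →ᵇ ℝ) X))),
    ?_, fun q => ?_⟩
  · simp only [Submodule.coe_iInf]
    exact isClosed_iInter fun v => ContinuousLinearMap.isClosed_eqLocus _ _
  · simp only [Submodule.mem_iInf, LinearMap.mem_eqLocus, ContinuousLinearMap.coe_coe]
    exact forall_congr' fun v => by rw [ContinuousLinearMap.comp_apply, hT]; rfl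

/-! ## § 4 The open-mapping upgrade (registered sub-goal `stub_poissonCorrector_of_exists`) -/

/-- **Registered sub-goal `stub_poissonCorrector_of_exists` of S1** (line `enskog-compensator-martingale`,
crux stmt-AtomisticToContinuum-13915). QUALITATIVE bounded solvability of `L ψ = g` on bounded continuous
`g ⊥_M span{1, v, |v|²}` (some bounded pre-image for each such `g`, no control of its size)
— a bounded MEASURABLE pre-image suffices, it is automatically continuous (`continuous_of_bounded_of_eq`) —
already gives S1 with a UNIFORM constant: `∃ C₀ > 0`, every such `g` with `|g| ≤ b` has a continuous
pre-image `w` with `|w| ≤ C₀ b` and `L w = g` as functions. Proof: `L` restricted to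
`D = {ψ ∈ C_b : L ψ ∈ X}` has a closed graph `G ⊆ C_b × X` (sup bound `|L ψ (v)| ≤ 4 ν(v) ‖ψ‖_∞`),
`G` and `X` are Banach, `(ψ, g) ↦ g` is a continuous linear surjection `G → X`, and Banach's open mapping
theorem (`ContinuousLinearMap.exists_preimage_norm_le`) gives pre-images of norm `≤ C ‖g‖_∞ ≤ C b`.
This is step (iii) of the refuters' route for the twin stub `stub_chapmanEnskogInverse` of crux
stmt-AtomisticToContinuum-10967: the borderline asymptotic analysis need only produce SOME bounded
pre-image, constants come for free. [folklore] -/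
theorem stub_poissonCorrector_of_exists :
    (∀ (g : V3 → ℝ) (b : ℝ), Continuous g → (∀ v, |g v| ≤ b) →
      (∀ φ ∈ collisionInvariants V3, maxwellianInner g φ = 0) →
      ∃ ψ : V3 → ℝ, Measurable ψ ∧ (∃ B : ℝ, ∀ v, |ψ v| ≤ B) ∧ ∀ v, hardSphereLinearizedOp ψ v = g v) →
    ∃ C₀ : ℝ, 0 < C₀ ∧ ∀ (g : V3 → ℝ) (b : ℝ), Continuous g → (∀ v, |g v| ≤ b) → Orthogonal g →
      ∃ w : V3 → ℝ, Continuous w ∧ (∀ v, |w v| ≤ C₀ * b) ∧ hardSphereLinearizedOp w = g := by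
  intro H
  obtain ⟨X, hXc, hXmem⟩ := exists_orthSubspace
  haveI : CompleteSpace X := hXc.completeSpace_coe
  obtain ⟨G, hGc, hGmem⟩ := exists_graphSubspace X
  haveI : CompleteSpace G := hGc.completeSpace_coe
  -- the projection `G → X`, `(ψ, g) ↦ g`, is onto by the qualitative solvability
  set P : G →L[ℝ] X := (ContinuousLinearMap.snd ℝ (V3 →ᵇ ℝ) X).comp G.subtypeL with hP
  have hPapply : ∀ q : G, P q = (q : (V3 →ᵇ ℝ) × X).2 := fun q => rfl
  have hsurj : Function.Surjective P := by
    intro y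
    have hy : Orthogonal ⇑(y : V3 →ᵇ ℝ) := (hXmem _).1 y.2
    obtain ⟨ψ, hψm, ⟨B, hB⟩, hL⟩ := H ⇑(y : V3 →ᵇ ℝ) ‖(y : V3 →ᵇ ℝ)‖ (y : V3 →ᵇ ℝ).continuous
      (abs_apply_le_norm _) (orthogonal_iff.1 hy)
    have hψc : Continuous ψ := continuous_of_bounded_of_eq hψm hB (y : V3 →ᵇ ℝ).continuous hL
    obtain ⟨ψb, hψb, -⟩ := exists_bcf_of_bounded hψc hB
    have hmem : (ψb, y) ∈ G := (hGmem _).2 fun v => by rw [hψb]; exact hL v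
    exact ⟨⟨(ψb, y), hmem⟩, rfl⟩
  -- Banach's open mapping theorem
  obtain ⟨C, hC, hpre⟩ := P.exists_preimage_norm_le hsurj
  refine ⟨C, hC, fun g b hg hb horth => ?_⟩
  obtain ⟨gb, hgb, hgbn⟩ := exists_bcf_of_bounded hg hb
  have hgmem : gb ∈ X := (hXmem gb).2 (by rw [hgb]; exact horth)
  obtain ⟨x, hx, hxn⟩ := hpre ⟨gb, hgmem⟩
  have hxG := (hGmem _).1 x.2
  have hx2 : ((x : (V3 →ᵇ ℝ) × X).2 : V3 →ᵇ ℝ) = gb := by rw [← hPapply, hx]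
  refine ⟨⇑(x : (V3 →ᵇ ℝ) × X).1, (x : (V3 →ᵇ ℝ) × X).1.continuous, fun v => ?_, funext fun v => ?_⟩
  · calc |(x : (V3 →ᵇ ℝ) × X).1 v| ≤ ‖(x : (V3 →ᵇ ℝ) × X).1‖ := abs_apply_le_norm _ v
      _ ≤ ‖(x : (V3 →ᵇ ℝ) × X)‖ := norm_fst_le _
      _ = ‖x‖ := rfl
      _ ≤ C * ‖(⟨gb, hgmem⟩ : X)‖ := hxn
      _ = C * ‖gb‖ := rfl
      _ ≤ C * b := mul_le_mul_of_nonneg_left hgbn hC.le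
  · rw [hxG v, hx2, hgb]

/-! ## § 5 S1 from the sup-norm statement in the Literature vocabulary -/

/-- **S1 from the bounded Chapman–Enskog inverse in the Literature vocabulary** (the mechanical bridge):
if some absolute `C₀` gives every bounded continuous `g ⊥_M collisionInvariants` a continuous pre-image
`ψ` with `|ψ| ≤ C₀ ‖g‖_∞` and `L ψ = g` pointwise — the borderline sup-norm theorem crux
stmt-AtomisticToContinuum-10967's seat is building under `Literature/Analysis/UnboundedOperators/` — then
the registered stub `stub_poissonCorrector` holds verbatim. Only the orthogonality clause is translated
(`orthogonal_iff`) and the pointwise equation is packaged as an equality of functions. [folklore] -/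
theorem stub_poissonCorrector_of_bounded
    (H : ∃ C₀ : ℝ, 0 < C₀ ∧ ∀ (g : V3 → ℝ) (b : ℝ), Continuous g → (∀ v, |g v| ≤ b) →
      (∀ φ ∈ collisionInvariants V3, maxwellianInner g φ = 0) →
      ∃ ψ : V3 → ℝ, Continuous ψ ∧ (∀ v, |ψ v| ≤ C₀ * b) ∧ ∀ v, hardSphereLinearizedOp ψ v = g v) :
    ∃ C₀ : ℝ, 0 < C₀ ∧ ∀ (g : V3 → ℝ) (b : ℝ), Continuous g → (∀ v, |g v| ≤ b) → Orthogonal g →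
      ∃ w : V3 → ℝ, Continuous w ∧ (∀ v, |w v| ≤ C₀ * b) ∧ hardSphereLinearizedOp w = g := by
  obtain ⟨C₀, hC₀, h⟩ := H
  refine ⟨C₀, hC₀, fun g b hg hb horth => ?_⟩
  obtain ⟨ψ, hψ, hψb, hL⟩ := h g b hg hb (orthogonal_iff.1 horth)
  exact ⟨ψ, hψ, hψb, funext hL⟩

end Summit.AtomisticToContinuum.HydrodynamicLimit.Theorems.EnskogCompensator

end
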